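import Summits.ABC.ABC.Theses.CuspFieldPencil
import Summits.ABC.ABC.Theorems.YuMatveevShapeRatCloses
import Summits.ABC.ABC.Theorems.PlacewiseSzpiroSingleTowerSzpiroBakerSinglePlace
import Summits.ABC.ABC.Theorems.CuspFieldPencilGoldenFromNFPencil
import HarnessLib

/-!
# Stub-ideation sketch — `stub_splitCuspTriple` · ideator 3 · GEN 4 (HOME FAMILY 3: probe the extremes)

Crux `Summit.ABC.ABC.Theses.CuspFieldPencil.GoldenCuspShadow` (stmt-ABC-26026), route `CuspFieldPencil`.
SIGNATURES ONLY (`sorry` bodies) for the helper lemmas + kernel-checked EXTREMAL UNIT TESTS + the wiring/axiom audit.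

GEN-4 CUT (converged line k1-g3 / k2-g4 / k3-g3, in k2-g4's one-ratio form, re-cut GENERICALLY):
* ORL = "one-ratio lemmas": the two clauses of `Pasten.approx_div` with the abc-triple packaging replaced by its
  actual content `1 − ζ·y/z = m/z` (`m ∈ ℤ` the "dirty" member, never factorised) — `orl_arch`, `orl_padic_dvd`
  (divisor form: only the primes of a divisor `d ∣ m` coprime to `z` are paid). Reusable verbatim by the sibling
  stub (`T_∞ : u² − Q = w(w+11u)`) and by every two-rational-cusp pencil.
* specialisation to the cusp-0 ratio `ξ₀ = −Q/w²`, `1 − ξ₀ = u(u−11w)/w²` (`Q = u² − 11uw − w²`), `d = |u|`.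
* pre-bound ⇒ endgame (self-improvement) ⇒ `RouteU` ⇒ swap ⇒ `RouteW` ⇒ min-form ⇒ STUB and CRUX.
Input: the tree THEOREM `Summit.ABC.ABC.Theorems.approximationBound_rat_holds` (no hypothesis survives).
-/

set_option linter.dupNamespace false

noncomputable section

open Finset Real Height
open Literature.NumberTheory.DiophantineGeometry
open Literature.NumberTheory.DiophantineGeometry.Dioph
open Literature.NumberTheory.DiophantineGeometry.Pasten
open Literature.Barriers.ABC

namespace Summit.ABC.ABC.Cruxes.GoldenCuspShadow.SplitK3G4

/-! ### 0 · Statements -/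

/-- The registered stub `stub_splitCuspTriple`, verbatim. -/
def StubSplit : Prop :=
  ∀ ε : ℝ, 0 < ε → ∃ κ : ℝ, ∀ u w : ℤ, IsCoprime u w → u * w * (u ^ 2 - 11 * u * w - w ^ 2) ≠ 0 →
    Real.log (max (|(u : ℝ)|) (|(w : ℝ)|)) ≤
      κ * (((UniqueFactorizationMonoid.radical (u * w * (u ^ 2 - 11 * u * w - w ^ 2))).natAbs : ℕ) : ℝ) ^ (ε : ℝ) *
        (((((UniqueFactorizationMonoid.radical u).natAbs : ℕ) : ℝ) *
            (((UniqueFactorizationMonoid.radical w).natAbs : ℕ) : ℝ)) ^ (2 / 3 : ℝ) *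
          (((UniqueFactorizationMonoid.radical (u ^ 2 - 11 * u * w - w ^ 2)).natAbs : ℕ) : ℝ) ^ (1 / 3 : ℝ))

/-- `RouteU`: `log max(|u|,|w|) ≤ κ_ε · rad(uwQ)^ε · rad|u|` (cusp `t = 0`). Same text as k2-g4 `RouteU`, k1/k3-g3 `RouteBoundU`. -/
def RouteU : Prop :=
  ∀ ε : ℝ, 0 < ε → ∃ κ : ℝ, ∀ u w : ℤ, IsCoprime u w → u * w * (u ^ 2 - 11 * u * w - w ^ 2) ≠ 0 →
    Real.log (max (|(u : ℝ)|) (|(w : ℝ)|)) ≤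
      κ * (((UniqueFactorizationMonoid.radical (u * w * (u ^ 2 - 11 * u * w - w ^ 2))).natAbs : ℕ) : ℝ) ^ ε *
        (((UniqueFactorizationMonoid.radical u).natAbs : ℕ) : ℝ)

/-- `RouteW`: the same with `rad|w|` (cusp `t = ∞`; = `RouteU` at `(w, −u)`). -/
def RouteW : Prop :=
  ∀ ε : ℝ, 0 < ε → ∃ κ : ℝ, ∀ u w : ℤ, IsCoprime u w → u * w * (u ^ 2 - 11 * u * w - w ^ 2) ≠ 0 →
    Real.log (max (|(u : ℝ)|) (|(w : ℝ)|)) ≤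
      κ * (((UniqueFactorizationMonoid.radical (u * w * (u ^ 2 - 11 * u * w - w ^ 2))).natAbs : ℕ) : ℝ) ^ ε *
        (((UniqueFactorizationMonoid.radical w).natAbs : ℕ) : ℝ)

/-- The binary quadratic cusp form `Q = u² − 11uw − w²` (abbreviation for intermediate statements only;
the final statements spell it out). -/
def qQ (u w : ℤ) : ℤ := u ^ 2 - 11 * u * w - w ^ 2

theorem qQ_def (u w : ℤ) : qQ u w = u ^ 2 - 11 * u * w - w ^ 2 := rfl

/-- Pasten's `Θ` at threshold `0` on the two CLEAN members `|Q|, w²` of `T₀`. -/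
def ThQ (K : ℝ) (u w : ℤ) : ℝ := theta K (qQ u w).natAbs (w ^ 2).natAbs 0

/-- The log term `Y₀ = log max{e, log|Q| + log w²}` (`≥` Pasten's `log max{e, h(ξ₀)}`). -/
def YQ (u w : ℤ) : ℝ :=
  Real.log (max (Real.exp 1) (Real.log (((qQ u w).natAbs : ℕ) : ℝ) + Real.log (((w ^ 2).natAbs : ℕ) : ℝ)))

/-! ### 1 · Wiring / axiom audit: the input is a THEOREM of the tree -/

/-- The LFL input of the whole line, by name (Pasten 2024 Thm 2.1 over `ℚ`, proved in tree). -/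
theorem input_unconditional : ∃ K : ℝ, 1 ≤ K ∧ PastenApproximationBound K :=
  Summit.ABC.ABC.Theorems.approximationBound_rat_holds

/-! ### 2 · The hidden identity and its swap (kernel-checked, `ring`) -/

/-- `T₀`: `w² + Q = u(u − 11w)`. [folklore] -/
theorem t0_identity (u w : ℤ) : w ^ 2 + qQ u w = u * (u - 11 * w) := by
  rw [qQ_def]; ring

/-- The swap `(u, w) ↦ (w, −u)` negates `Q` and fixes `u·w·Q` literally. [folklore] -/
theorem qQ_swap (u w : ℤ) : qQ w (-u) = -qQ u w := by
  simp only [qQ_def]; ring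

theorem prod_swap (u w : ℤ) :
    w * -u * (w ^ 2 - 11 * w * -u - (-u) ^ 2) = u * w * (u ^ 2 - 11 * u * w - w ^ 2) := by ring

/-! ### 3 · EXTREMAL / DEGENERATE UNIT TESTS (kernel-checked) -/

-- (E1) the only coprime pairs with `u(u−11w) = 0`, `uwQ ≠ 0` are `±(11,1)` (cusp-0 escape; `Q = −1`, `H = 11`);
--      after the swap the escape is `±(1,−11)`.
example : (11 : ℤ) * (11 - 11 * 1) = 0 ∧ qQ 11 1 = -1 ∧ qQ 1 (-11) = 1 ∧ (1 : ℤ) - 11 * (-11) ≠ 0 := by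
  refine ⟨by norm_num, by norm_num [qQ_def], by norm_num [qQ_def], by norm_num⟩
-- (E2) side condition `1 < |Q|·w²` of the one call: value 1 exactly at the escape (11,1); already 11 at (12,1), (1,±1).
example : (qQ 11 1).natAbs * ((1 : ℤ) ^ 2).natAbs = 1 ∧ (qQ 12 1).natAbs * ((1 : ℤ) ^ 2).natAbs = 11 ∧
    (qQ 1 1).natAbs = 11 ∧ (qQ 1 (-1)).natAbs = 11 := by
  refine ⟨by decide, by decide, by decide, by decide⟩
-- (E3) the p = 11 valuation JUMP (the only prime with ν_p(u(u−11w)) > ν_p(u): gcd(u, u−11w) ∣ 11):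
--      (u,w) = (22,1): m = 22·11 = 242 = 2·11², so ν₁₁(u) = 1 < ν₁₁(m) = 2 — ORL-padic must use `≤`, never `=`.
example : (22 : ℤ) * (22 - 11 * 1) = 242 ∧ (11 : ℕ) ^ 2 ∣ 242 ∧ ¬ (11 : ℕ) ^ 2 ∣ 22 ∧ qQ 22 1 = 241 := by
  refine ⟨by norm_num, by decide, by decide, by norm_num [qQ_def]⟩
-- (E4) `gcd(m, z) = gcd(u(u−11w), w²) = 1` on samples (generic reason: `gcd(u−11w, w) = gcd(u, w)`).
example : Nat.gcd (22 * 11) 1 = 1 ∧ Nat.gcd (13 * (13 + 22)) 4 = 1 ∧ Int.gcd (255 * (255 - 11 * 23)) (23 ^ 2) = 1 := by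
  refine ⟨by decide, by decide, by decide⟩
-- (E5) near the irrational cusp t = φ⁵ ≈ 11.09: (255,23): `|u − 11w| = 2`, `Q = −19`; the archimedean clause
--      `2 log|w| − log|u| − log|u−11w| < Θ₀Y₀` has left side ≈ 0.04 there (no tension); on `(1, w)` it is ≈ log(w/11)
--      (all the tension sits in Θ₀, i.e. in rad(w·Q(1,w)) — Baker).
example : (255 : ℤ) - 11 * 23 = 2 ∧ qQ 255 23 = -19 ∧ (23 : ℤ) ^ 2 = 529 ∧ (255 : ℤ) * 2 = 510 := by
  refine ⟨by norm_num, by norm_num [qQ_def], by norm_num, by norm_num⟩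
-- (E6) `R^ε` is essential in RouteU: `(1, 2^a)` has `rad u = 1`, `L = a log 2 → ∞` (so no ε = 0 version);
--      `(1, 2^7)`: Q = 1 − 11·128 − 16384 = −17791.
example : IsCoprime (1 : ℤ) (2 ^ 7) ∧ qQ 1 (2 ^ 7) = -17791 := ⟨isCoprime_one_left, by norm_num [qQ_def]⟩

/-! ### 4 · GENERIC one-ratio lemmas (ORL) — perturbations of `Pasten.arch_bound` / `Pasten.padic_bound_a` -/

/-- **ORL-arch** (parent `Pasten.arch_bound`, PastenSubexpPlaces.lean:145, same 30-line proof with `a/c` replaced by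
`m/z`): for coprime non-zero naturals `y, z` with `yz > 1`, `ζ = ±1`, and an integer `m ≠ 0` with
`1 − ζ·y/z = m/z`: `log z − log|m| < Θ₀(y,z) · log max{e, log y + log z}`
(clause 1 of `approx_div`; `|1 − ξ| = |m|/z`; `h(ξ) ≤ log y + log z` by `logHeight₁_sign_mul_div_le`). [S, ~35 ll.] -/
theorem orl_arch {K : ℝ} (hK : 1 ≤ K) (hP : PastenApproximationBound K)
    {y z : ℕ} (hy : y ≠ 0) (hz : z ≠ 0) (hyz : y.Coprime z) (h1 : 1 < y * z)
    {ζ : ℚ} (hζ : ζ = 1 ∨ ζ = -1) {m : ℤ} (hm : m ≠ 0)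
    (hξ : (1 : ℚ) - ζ * ((y : ℚ) / z) = (m : ℚ) / z) :
    Real.log z - Real.log |(m : ℝ)| <
      theta K y z 0 * Real.log (max (Real.exp 1) (Real.log y + Real.log z)) := by
  sorry

/-- **ORL-padic, divisor form** (parents `Pasten.padic_bound_a` :178 for the valuation step and
`Literature.Barriers.ABC.log_lt_route_a` :338–350 for the summation): with the data of `orl_arch` and a divisor
`d ∣ |m|` coprime to `z`: `log d ≤ 3 · Θ₀(y,z) · log max{e, log y + log z} · ∑_{p ∣ d} p`
(`log d = ∑ ν_p(d) log p`; `ν_p(d) ≤ ν_p(m) = ord_p(m/z) = ord_p(1 − ξ)` since `p ∤ z`; clause 2 of `approx_div`;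
`log max{e, p·h} ≤ log p + log max{e, h}` (`log_max_exp_mul_le`); `(p/log p)(log p + Y) ≤ 3pY` (`div_log_mul_add_le`)).
THE ONLY M-SIZED HELPER. [M−, ~60 ll.] -/
theorem orl_padic_dvd {K : ℝ} (hK : 1 ≤ K) (hP : PastenApproximationBound K)
    {y z : ℕ} (hy : y ≠ 0) (hz : z ≠ 0) (hyz : y.Coprime z) (h1 : 1 < y * z)
    {ζ : ℚ} (hζ : ζ = 1 ∨ ζ = -1) {m : ℤ} (hm : m ≠ 0)
    (hξ : (1 : ℚ) - ζ * ((y : ℚ) / z) = (m : ℚ) / z)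
    {d : ℕ} (hd : d ∣ m.natAbs) (hdz : d.Coprime z) :
    Real.log d ≤ 3 * theta K y z 0 * Real.log (max (Real.exp 1) (Real.log y + Real.log z)) *
      ∑ p ∈ d.primeFactors, (p : ℝ) := by
  sorry

/-! ### 5 · Specialisation to the cusp-0 ratio `ξ₀ = −Q/w²` -/

/-- **cusp-0 data**: for coprime `u, w` with `uwQ ≠ 0` and `u ≠ 11w`, the tuple
`(y, z, ζ, m, d) = (|Q|, w², −sgn Q, u(u−11w), |u|)` satisfies every hypothesis of ORL
(`Int.sign_mul_natAbs`, `t0_identity`, `isCoprime_quadForm_right`, E1/E2 for `1 < |Q|w²`). [S, ~40 ll.] -/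
theorem cusp0_data {u w : ℤ} (h : IsCoprime u w) (h0 : u * w * (u ^ 2 - 11 * u * w - w ^ 2) ≠ 0)
    (hne : u ≠ 11 * w) :
    (qQ u w).natAbs ≠ 0 ∧ (w ^ 2).natAbs ≠ 0 ∧ (qQ u w).natAbs.Coprime (w ^ 2).natAbs ∧
      1 < (qQ u w).natAbs * (w ^ 2).natAbs ∧
      ((-((Int.sign (qQ u w) : ℤ) : ℚ)) = 1 ∨ (-((Int.sign (qQ u w) : ℤ) : ℚ)) = -1) ∧
      u * (u - 11 * w) ≠ 0 ∧
      (1 : ℚ) - (-((Int.sign (qQ u w) : ℤ) : ℚ)) * ((((qQ u w).natAbs : ℕ) : ℚ) / (((w ^ 2).natAbs : ℕ) : ℚ)) =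
        ((u * (u - 11 * w) : ℤ) : ℚ) / (((w ^ 2).natAbs : ℕ) : ℚ) ∧
      u.natAbs ∣ (u * (u - 11 * w)).natAbs ∧ u.natAbs.Coprime (w ^ 2).natAbs := by
  sorry

/-- **escape pairs**: coprime `u = 11w` forces `(u, w) = ±(11, 1)`, so `log max(|u|,|w|) = log 11`. [XS] -/
theorem escape_eq {u w : ℤ} (h : IsCoprime u w) (hu : u = 11 * w) :
    max (|(u : ℝ)|) (|(w : ℝ)|) = 11 := by
  sorry

/-- **pre-bound at cusp 0** (ORL-arch + ORL-padic on the cusp-0 data; transfer `|u − 11w| ≤ 12·max(|u|,|w|)`,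
two cases `|w| ≤ |u|` / `|u| < |w|`):
`log max(|u|,|w|) ≤ log 12 + Θ₀ · Y₀ · (1 + 3 ∑_{p ∣ u} p)`. [S, ~45 ll.] -/
theorem pre_route_u {K : ℝ} (hK : 1 ≤ K) (hP : PastenApproximationBound K) {u w : ℤ}
    (h : IsCoprime u w) (h0 : u * w * (u ^ 2 - 11 * u * w - w ^ 2) ≠ 0) (hne : u ≠ 11 * w) :
    Real.log (max (|(u : ℝ)|) (|(w : ℝ)|)) ≤
      Real.log 12 + ThQ K u w * YQ u w * (1 + 3 * ∑ p ∈ u.natAbs.primeFactors, (p : ℝ)) := by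
  sorry

/-! ### 6 · Accounting (all radicals inside `rad(uwQ)`) -/

/-- `Y₀ ≤ log max{e, log 13 + 4L}` (`|Q| ≤ 13H²`, `w² ≤ H²`, `H = max(|u|,|w|) ≥ 1`). [S, ~30 ll.] -/
theorem YQ_le {u w : ℤ} (hu : u ≠ 0) (hw : w ≠ 0) :
    YQ u w ≤ Real.log (max (Real.exp 1) (Real.log 13 + 4 * Real.log (max (|(u : ℝ)|) (|(w : ℝ)|)))) := by
  sorry

/-- `Θ₀(|Q|, w²) ≤ K · C · rad(uwQ)^η` — ONE call of `SingleTowerSzpiroLine.theta_zero_le_mul_rpow` with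
`(u,v,a,b,c) := (|Q|, w², |Q|, w², |u|)` (`hdvd := dvd_mul_right _ _`), then `rad |Q| w² |u| = (radical (uwQ)).natAbs`
(`Nat.primeFactors` of `natAbs`/`pow`, `Int.radical_natAbs_eq_radical`, `GoldenFromNFPencil.natAbs_radical_prod`). [S, ~35 ll.] -/
theorem ThQ_le {K C η : ℝ} (hK : 1 ≤ K) (hη : 0 ≤ η)
    (hC : ∀ S : Finset ℕ, (∀ p ∈ S, p.Prime) → ∏ p ∈ S, K * Real.log p / (p : ℝ) ^ η ≤ C)
    {u w : ℤ} (h : IsCoprime u w) (h0 : u * w * (u ^ 2 - 11 * u * w - w ^ 2) ≠ 0) :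
    ThQ K u w ≤ K * C * (((UniqueFactorizationMonoid.radical (u * w * (u ^ 2 - 11 * u * w - w ^ 2))).natAbs : ℕ) : ℝ) ^ η := by
  sorry

/-- `1 + 3 ∑_{p ∣ |u|} p ≤ 4 · rad|u|` and `1 ≤ rad|u| ≤ rad(uwQ)` (as reals)
(`sum_le_prod_of_two_le`, `Int.radical_eq_prod_primeFactors`, `natAbs_radical_prod`). [S, ~30 ll.] -/
theorem sum_le_rad {u w : ℤ} (h : IsCoprime u w) (h0 : u * w * (u ^ 2 - 11 * u * w - w ^ 2) ≠ 0) :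
    (1 : ℝ) + 3 * ∑ p ∈ u.natAbs.primeFactors, (p : ℝ) ≤ 4 * (((UniqueFactorizationMonoid.radical u).natAbs : ℕ) : ℝ) ∧
      (1 : ℝ) ≤ (((UniqueFactorizationMonoid.radical u).natAbs : ℕ) : ℝ) ∧
      (((UniqueFactorizationMonoid.radical u).natAbs : ℕ) : ℝ) ≤
        (((UniqueFactorizationMonoid.radical (u * w * (u ^ 2 - 11 * u * w - w ^ 2))).natAbs : ℕ) : ℝ) := by
  sorry

/-! ### 7 · Endgame (pure real analysis; parent `Literature.Barriers.ABC.le_of_le_mul_log_max`) -/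

/-- **endgame / self-improvement**: from `L ≤ A + A·R^η·m·log max{e, log 13 + 4L}` (`A ≥ 1`, `η > 0`, `0 ≤ L`,
`1 ≤ m ≤ R`) to `L ≤ κ(A,η) · R^{2η} · m`: put `y = 2L + (log 13)/2`, `M = 2A + (log 13)/2 + 2A R^η m ≥ 1`, get
`y ≤ 2M log(4M)` (`le_of_le_mul_log_max`), `log(4M) ≤ c + (1+η) log R ≤ c + (1+η) R^η/η` (`Real.log_le_rpow_div`). [S, ~50 ll.] -/
theorem endgame {A η : ℝ} (hA : 1 ≤ A) (hη : 0 < η) :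
    ∃ κ : ℝ, 0 ≤ κ ∧ ∀ L R m : ℝ, 0 ≤ L → 1 ≤ m → m ≤ R →
      L ≤ A + A * R ^ η * m * Real.log (max (Real.exp 1) (Real.log 13 + 4 * L)) →
      L ≤ κ * R ^ (2 * η) * m := by
  sorry

/-! ### 8 · Assembly -/

/-- **RouteU** (`⟨K,hK,hP⟩ := approximationBound_rat_holds`; `η := ε/2`; `C` from
`SingleTowerSzpiroLine.exists_prod_mul_log_div_rpow_le (A := K)`; `A := 4KC`; escape pairs by `escape_eq`
(`κ ≥ log 11`); otherwise `pre_route_u` + `YQ_le` + `ThQ_le` + `sum_le_rad` + `endgame`). [S/M, ~60 ll.] -/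
theorem routeU : RouteU := by
  sorry

/-- **RouteW from RouteU** at `(w, −u)`: `IsCoprime.neg_right`, `prod_swap` (the radical argument is literally
`u·w·Q` again), `abs_neg`, `max_comm`. [S, ~25 ll.] -/
theorem routeW_of_routeU (hU : RouteU) : RouteW := by
  sorry

/-- **the stub from the two routes**: `min(rad u, rad w) ≤ (rad u · rad w)^{1/2} ≤ (rad u · rad w)^{2/3}` and
`1 ≤ rad(Q)^{1/3}` (all bases `≥ 1`; `Real.rpow_le_rpow_left_iff`/`Real.one_le_rpow`). [S, ~40 ll.] -/
theorem stubSplit_of_routes (hU : RouteU) (hW : RouteW) : StubSplit := by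
  sorry

/-- **the CRUX from the two routes**: `L² ≤ κ² R^{2ε'} rad u · rad w ≤ κ² R^{2ε'} · R`
(`natAbs_radical_prod`: `rad u · rad w · rad Q = R`), i.e. `L ≤ κ R^{1/2 + ε'}`. [S, ~40 ll.] -/
theorem goldenCuspShadow_of_routes (hU : RouteU) (hW : RouteW) :
    Summit.ABC.ABC.Theses.CuspFieldPencil.GoldenCuspShadow := by
  sorry

/-- Kernel-checked composition: the registered stub, by the verbatim signature. -/
theorem stubSplit : StubSplit :=
  stubSplit_of_routes routeU (routeW_of_routeU routeU)

/-- Kernel-checked composition: the crux BY NAME. -/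
theorem goldenCuspShadow : Summit.ABC.ABC.Theses.CuspFieldPencil.GoldenCuspShadow :=
  goldenCuspShadow_of_routes routeU (routeW_of_routeU routeU)

/-! ### 9 · Elaboration checks of the parents (shapes as used above) -/

example {K : ℝ} (hK : 1 ≤ K) (hP : PastenApproximationBound K) {y z : ℕ} (hy : y ≠ 0) (hz : z ≠ 0)
    (hyz : y.Coprime z) (h1 : 1 < y * z) {ζ : ℚ} (hζ : ζ = 1 ∨ ζ = -1) (hξ1 : ζ * ((y : ℚ) / z) ≠ 1) :=
  approx_div hK hP hy hz hyz h1 0 hζ hξ1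

example {K C η : ℝ} (hK : 1 ≤ K) (hη : 0 ≤ η)
    (hC : ∀ S : Finset ℕ, (∀ p ∈ S, p.Prime) → ∏ p ∈ S, K * Real.log p / (p : ℝ) ^ η ≤ C)
    {u v a b c : ℕ} (hu : u ≠ 0) (hv : v ≠ 0) (huv : u.Coprime v) (hdvd : u * v ∣ a * b * c)
    (h0 : a * b * c ≠ 0) : theta K u v 0 ≤ K * C * (rad a b c : ℝ) ^ η :=
  Summit.ABC.ABC.Theorems.SingleTowerSzpiroLine.theta_zero_le_mul_rpow hK hη hC hu hv huv hdvd h0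

example {A η : ℝ} (hA : 0 ≤ A) (hη : 0 < η) :=
  Summit.ABC.ABC.Theorems.SingleTowerSzpiroLine.exists_prod_mul_log_div_rpow_le hA hη

example {y M : ℝ} (hM : 1 ≤ M) (h : y ≤ M * Real.log (max (Real.exp 1) (2 * y))) :
    y ≤ 2 * M * Real.log (4 * M) :=
  Literature.Barriers.ABC.le_of_le_mul_log_max hM h

example {p Y : ℝ} (hp : 2 ≤ p) (hY : 1 ≤ Y) : p / Real.log p * (Real.log p + Y) ≤ 3 * p * Y :=
  Literature.Barriers.ABC.div_log_mul_add_le hp hY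

example {p t : ℝ} (hp : 1 ≤ p) := log_max_exp_mul_le (t := t) hp

example {u v : ℕ} (hu : u ≠ 0) (hv : v ≠ 0) {ζ : ℚ} (hζ : ζ = 1 ∨ ζ = -1) :
    logHeight₁ (ζ * ((u : ℚ) / v)) ≤ Real.log u + Real.log v :=
  logHeight₁_sign_mul_div_le hu hv hζ

example {n : ℕ} (hn : n ≠ 0) := Literature.Barriers.ABC.log_eq_sum_factorization_mul_log hn

example {s : Finset ℕ} (hs : ∀ p ∈ s, 2 ≤ p) := Literature.Barriers.ABC.sum_le_prod_of_two_le hs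

example {u w : ℤ} (h : IsCoprime u w) :=
  Summit.ABC.ABC.Theorems.GoldenFromNFPencil.natAbs_radical_prod h

example (z : ℤ) : ((UniqueFactorizationMonoid.radical z.natAbs : ℕ) : ℤ) = UniqueFactorizationMonoid.radical z :=
  Int.radical_natAbs_eq_radical

end Summit.ABC.ABC.Cruxes.GoldenCuspShadow.SplitK3G4

end
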